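import Mathlib
import Literature.Analysis.FluidPDE.Tao2016AveragedNS.RestartedCascadeFlows
import Summits.NavierStokesRegularity.NavierStokesRegularity.Theses.TaoLadderRungThree
import Summits.NavierStokesRegularity.NavierStokesRegularity.Theses.TaoLadderRungTwo
import HarnessLib

/-!
# `RestartGlue` — a checkpoint step of the restarted flow is a level-`N+1` epoch checkpoint
  (item stmt-NavierStokesRegularity-20425, shared support of routes TaoLadderRungThree / TaoLadderRungTwo)

HONEST FRAMING: definitional bookkeeping about Tao-type MODEL lattice pseudo-flows (Tao 2016, §6.2
Prop. 6.3 (vi)–(ix) and the §6.4 rescaling at a checkpoint, in the cell vocabulary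
`TaoCascade.EpochCheckpoints` / `StepTo` / `restartX` / `restartE` of the tree module
`RestartedCascadeFlows`). Nothing here is a statement about the Navier–Stokes equations, and nothing
is asserted about any particular coefficient table.

**Statement (`RestartGlue`).** If `(X, E, t, e)` carries epoch checkpoints up to level `N ≥ n₀` and
the flow restarted at the checkpoint `(N, t_N, e_N)` — `S_{i,k}(s) = X_{i,N+k}(t_N + s/γ)/e_N`,
`F = E/e_N²`, `γ = e_N (1+ε₀)^{5N/2}` — admits a checkpoint step `StepTo … τ₁ a`, then updating the two
bookkeeping sequences at `N+1` by `t_{N+1} := t_N + τ₁/γ`, `e_{N+1} := a·e_N` gives epoch checkpoints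
up to level `N+1`.

PROOF. `Function.update` leaves the levels `≤ N` untouched, so every clause at a level `n ≤ N` is the
old one. At `n = N+1`: positivity from `a > 0`, `e_N > 0`; the amplitude clause from
`a ≤ |S_{i₀,1}(τ₁)| = |X_{i₀,N+1}(t_{N+1})|/e_N`; the state clause by `funext` and
`N + (1 + k) = N + 1 + k`, `X/e_N/a = X/(a e_N)`; monotonicity from `τ₁ > 0`, `γ > 0`; the lifespan
clause from `τ₁ ≤ c` (`τ₁/γ ≤ c (1+ε₀)^{-5N/2} e_N⁻¹`); the ratio clause from `(1+ε₀)^{-θ} ≤ a`; the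
epoch clause by the affine substitution `s' = (s − t_N) γ ∈ [0, τ₁]`.
-/

noncomputable section

-- the sub-problem namespace `Summit.NavierStokesRegularity.NavierStokesRegularity` repeats the summit name by design (D-0017)
set_option linter.dupNamespace false

namespace Summit.NavierStokesRegularity.NavierStokesRegularity.Theorems

open Set Literature.Analysis.FluidPDE Literature.Analysis.FluidPDE.TaoCascade

namespace RestartGlue

variable {ε₀ θ c : ℝ} {m : ℕ} {i₀ : Fin m} {n₀ : ℤ} {X₀ : Fin m → ℝ}
  {P Q : (Fin m → ℤ → ℝ) → (Fin m → ℤ → ℝ) → Prop} {N : ℤ} {X E : Fin m → ℤ → ℝ → ℝ}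
  {t e : ℤ → ℝ} {τ₁ a : ℝ}

/-- Updating a sequence at `N+1` leaves the entries `n ≤ N` untouched.
[cite: Tao2016AveragedNS, §6.4 (the definitions of t_{N+1}, e_{N+1})] -/
theorem update_apply_of_le {f : ℤ → ℝ} {v : ℝ} {n N : ℤ} (hn : n ≤ N) :
    Function.update f (N + 1) v n = f n :=
  Function.update_of_ne (by omega) _ _

/-- **`RestartGlue`, main lemma**: a `StepTo` of the flow restarted at the checkpoint `(N, t_N, e_N)`
is a level-`N+1` `EpochCheckpoints` of the original family with `t_{N+1} = t_N + τ₁/γ`,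
`e_{N+1} = a e_N`. [cite: Tao2016AveragedNS, §6.4 ("we set t_{N+1} := t_N + (1+ε₀)^{-5N/2} e_N⁻¹ τ₁ and e_{N+1} := μ₁ e_N") with §6.2 Prop. 6.3 (vi)–(ix)] -/
theorem epochCheckpoints_succ (hε₀ : 0 < ε₀) (hN : n₀ ≤ N)
    (h : EpochCheckpoints ε₀ θ c i₀ n₀ X₀ P Q N X E t e)
    (hst : StepTo ε₀ θ c i₀ P Q (restartX ε₀ N (t N) (e N) X) (restartE ε₀ N (t N) (e N) E) τ₁ a) :
    EpochCheckpoints ε₀ θ c i₀ n₀ X₀ P Q (N + 1) X E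
      (Function.update t (N + 1) (t N + τ₁ / (e N * (1 + ε₀) ^ ((5 : ℝ) * N / 2))))
      (Function.update e (N + 1) (a * e N)) := by
  obtain ⟨hτ₁, hτ₁c, ha, hθa, hamp, hP, hQ⟩ := hst
  have heN : 0 < e N := h.e_pos N hN le_rfl
  have hq : (0 : ℝ) < 1 + ε₀ := by linarith
  set γ : ℝ := e N * (1 + ε₀) ^ ((5 : ℝ) * N / 2) with hγ
  have hγpos : 0 < γ := mul_pos heN (Real.rpow_pos_of_pos hq _)
  set t' : ℤ → ℝ := Function.update t (N + 1) (t N + τ₁ / γ) with ht'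
  set e' : ℤ → ℝ := Function.update e (N + 1) (a * e N) with he'
  have ht'N1 : t' (N + 1) = t N + τ₁ / γ := by rw [ht', Function.update_self]
  have he'N1 : e' (N + 1) = a * e N := by rw [he', Function.update_self]
  have ht'le : ∀ n, n ≤ N → t' n = t n := fun n hn => by rw [ht', update_apply_of_le hn]
  have he'le : ∀ n, n ≤ N → e' n = e n := fun n hn => by rw [he', update_apply_of_le hn]
  have hNN : N + 1 - 1 = N := by ring
  refine
    { t_init := ?_, e_init := ?_, e_pos := ?_, amp := ?_, state := ?_, mono := ?_, life := ?_,
      ratio := ?_, epoch := ?_ }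
  · -- anchor time
    rw [ht'le n₀ hN]; exact h.t_init
  · -- anchor amplitude
    rw [he'le n₀ hN]; exact h.e_init
  · -- positivity of amplitudes
    intro n hn hnN
    rcases lt_or_eq_of_le hnN with hlt | rfl
    · rw [he'le n (by omega)]; exact h.e_pos n hn (by omega)
    · rw [he'N1]; exact mul_pos ha heN
  · -- amplitude clause
    intro n hn hnN
    rcases lt_or_eq_of_le hnN with hlt | rfl
    · rw [he'le n (by omega), ht'le n (by omega)]; exact h.amp n hn (by omega)
    · rw [he'N1, ht'N1]
      have h1 : restartX ε₀ N (t N) (e N) X i₀ 1 τ₁ = X i₀ (N + 1) (t N + τ₁ / γ) / e N := rfl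
      rw [h1, abs_div, abs_of_pos heN, le_div_iff₀ heN] at hamp
      exact hamp
  · -- transition-state description at the checkpoints
    intro n hn hnN
    rcases lt_or_eq_of_le hnN with hlt | rfl
    · rw [he'le n (by omega), ht'le n (by omega)]; exact h.state n hn (by omega)
    · have h1 : (fun i k => X i (N + 1 + k) (t' (N + 1)) / e' (N + 1)) =
          fun i k => restartX ε₀ N (t N) (e N) X i (1 + k) τ₁ / a := by
        funext i k
        rw [ht'N1, he'N1, show N + 1 + k = N + (1 + k) by ring]
        simp only [restartX]
        rw [← hγ, div_div, mul_comm a (e N)]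
      have h2 : (fun i k => E i (N + 1 + k) (t' (N + 1)) / e' (N + 1) ^ 2) =
          fun i k => restartE ε₀ N (t N) (e N) E i (1 + k) τ₁ / a ^ 2 := by
        funext i k
        rw [ht'N1, he'N1, show N + 1 + k = N + (1 + k) by ring]
        simp only [restartE]
        rw [← hγ, div_div, mul_pow, mul_comm (a ^ 2) (e N ^ 2)]
      rw [h1, h2]
      exact hP
  · -- checkpoint times increase
    intro n hn hnN
    rcases lt_or_eq_of_le hnN with hlt | rfl
    · rw [ht'le n (by omega), ht'le (n - 1) (by omega)]; exact h.mono n hn (by omega)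
    · rw [hNN, ht'N1, ht'le N le_rfl]
      have : 0 < τ₁ / γ := div_pos hτ₁ hγpos
      linarith
  · -- lifespan bound
    intro n hn hnN
    rcases lt_or_eq_of_le hnN with hlt | rfl
    · rw [ht'le n (by omega), ht'le (n - 1) (by omega), he'le (n - 1) (by omega)]
      exact h.life n hn (by omega)
    · rw [hNN, ht'N1, ht'le N le_rfl, he'le N le_rfl, add_sub_cancel_left]
      have hcast : ((N + 1 : ℤ) : ℝ) - 1 = (N : ℝ) := by push_cast; ring
      have hexp : (1 + ε₀) ^ (-(5 : ℝ) * (((N + 1 : ℤ) : ℝ) - 1) / 2) =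
          ((1 + ε₀) ^ ((5 : ℝ) * N / 2))⁻¹ := by
        rw [hcast, ← Real.rpow_neg hq.le]; congr 1; ring
      have hre : c * ((1 + ε₀) ^ ((5 : ℝ) * N / 2))⁻¹ * (e N)⁻¹ = c / γ := by
        rw [hγ]; ring
      rw [hexp, hre]
      exact div_le_div_of_nonneg_right hτ₁c hγpos.le
  · -- amplitude ratio
    intro n hn hnN
    rcases lt_or_eq_of_le hnN with hlt | rfl
    · rw [he'le n (by omega), he'le (n - 1) (by omega)]; exact h.ratio n hn (by omega)
    · rw [hNN, he'N1, he'le N le_rfl]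
      exact mul_le_mul_of_nonneg_right hθa heN.le
  · -- epoch description throughout the new epoch
    intro n hn hnN s hs
    rcases lt_or_eq_of_le hnN with hlt | rfl
    · rw [ht'le n (by omega), ht'le (n - 1) (by omega)] at hs
      rw [he'le (n - 1) (by omega)]
      exact h.epoch n hn (by omega) s hs
    · rw [hNN, ht'N1, ht'le N le_rfl] at hs
      rw [hNN, he'le N le_rfl]
      have hs' : (s - t N) * γ ∈ Icc 0 τ₁ := by
        refine ⟨mul_nonneg (by linarith [hs.1]) hγpos.le, ?_⟩
        exact (le_div_iff₀ hγpos).mp (by linarith [hs.2])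
      have hss : t N + (s - t N) * γ / γ = s := by
        rw [mul_div_cancel_right₀ _ hγpos.ne']; ring
      have h1 : (fun i k => restartX ε₀ N (t N) (e N) X i k ((s - t N) * γ)) =
          fun i k => X i (N + k) s / e N := by
        funext i k
        simp only [restartX]
        rw [← hγ, hss]
      have h2 : (fun i k => restartE ε₀ N (t N) (e N) E i k ((s - t N) * γ)) =
          fun i k => E i (N + k) s / e N ^ 2 := by
        funext i k
        simp only [restartE]
        rw [← hγ, hss]
      have hQs := hQ _ hs'
      rw [h1, h2] at hQs
      exact hQs

end RestartGlue

open RestartGlue in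
/-- **Item stmt-NavierStokesRegularity-20425** (`TaoLadderRungThree.RestartGlue`): a `StepTo` of the
flow restarted at checkpoint `(N, t_N, e_N)` is a level-`N+1` `EpochCheckpoints` of the original
family with `t_{N+1} = t_N + τ₁/γ`, `e_{N+1} = a e_N`. [cite: Tao2016AveragedNS, §6.4 with §6.2 Prop. 6.3 (vi)–(ix)] -/
theorem taoLadderRungThree_restartGlue_proof :
    Summit.NavierStokesRegularity.NavierStokesRegularity.Theses.TaoLadderRungThree.RestartGlue := by
  unfold Summit.NavierStokesRegularity.NavierStokesRegularity.Theses.TaoLadderRungThree.RestartGlue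
  intro ε₀ θ c m i₀ n₀ X₀ P Q N X E t e τ₁ a hε₀ hN h hst
  exact epochCheckpoints_succ hε₀ hN h hst

open RestartGlue in
/-- **The same item read in route TaoLadderRungTwo** (`TaoLadderRungTwo.RestartGlue`, the shared
support stmt-NavierStokesRegularity-20425; identical statement). [cite: Tao2016AveragedNS, §6.4 with §6.2 Prop. 6.3 (vi)–(ix)] -/
theorem taoLadderRungTwo_restartGlue_proof :
    Summit.NavierStokesRegularity.NavierStokesRegularity.Theses.TaoLadderRungTwo.RestartGlue := by
  unfold Summit.NavierStokesRegularity.NavierStokesRegularity.Theses.TaoLadderRungTwo.RestartGlue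
  intro ε₀ θ c m i₀ n₀ X₀ P Q N X E t e τ₁ a hε₀ hN h hst
  exact epochCheckpoints_succ hε₀ hN h hst

end Summit.NavierStokesRegularity.NavierStokesRegularity.Theorems

end
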